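import Summits.ResolutionOfSingularities.ResolutionOfSingularities.Theses.ShadowGame
import Summits.ResolutionOfSingularities.ResolutionOfSingularities.Theorems.WinToTorsorLU.Negative.ShadowGameWinFalse
import Summits.ResolutionOfSingularities.ResolutionOfSingularities.Theorems.ShadowGameWinR.Negative.MirrorR

/-!
# Crux `WinToTorsorLUR` (stmt-ResolutionOfSingularities-18185), negative side:
# the FORMAL CLAUSE of the repaired whistle is load-bearing for the antecedent `ShadowGameWinR`

`WinToTorsorLUR := ShadowGameWinR → TorsorLUPerfect` (route `ShadowGame`, rev 3).  Load-bearing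
analysis of its single hypothesis.  `ShadowGameWinR` differs from the retired rev-2 antecedent only
in the third clause of its terminal test (`FormalMono`: `clean c = w^A · v + g^p` coefficientwise for
a formal regular system of parameters `w`).  This file records, against the tree's named mirror of
the move generator (`Theorems/ShadowGameWin/Negative/Mirror.lean`, verbatim bodies; the route says
the moves are "verbatim as in rev 2"), that

* (tree, `Theorems/ShadowGameWinR/Negative/MirrorR.lean`: `shadowGameWinR_iff` — the route decl IS
  `∀ p prime, ∀ n ≥ 1, AWinsR p n`, `Iff.rfl`; `TerminalR`, `AWinsR` are reused from there);
* `aWinsR_of_aWinsOld` — a rev-2 win is a rev-3 win (the whistle only became more permissive);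
* `shadowGameWinR_false_without_formalClause` — with the formal clause DELETED the antecedent
  `∀ p prime, ∀ n ≥ 1, AWinsOld p n` (= the retired rev-2 `ShadowGameWin`) is false:
  B's period-6 trap in `SG_3(2)` over `𝔽₃` from `v² + u³v + u³v²` (tree: `Negative/Trap.lean`,
  `step_S0 … step_S5`, `not_terminal_of_inCycle`; assembly `run_fst_mem_cycle` / `play_eq_run` /
  `chart_mem` from `Theorems/WinToTorsorLU/Negative/ShadowGameWinFalse.lean`) beats every strategy — so ANY
  proof of `ShadowGameWinR`, hence any non-vacuous use of this crux, must go through the formal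
  clause; `withoutFormalClause_vacuous` spells out that the crux re-pointed at the clause-free
  antecedent proves anything.

(The rev-2 decl `ShadowGame.ShadowGameWin` is no longer declared in the route file, so the clause-free
antecedent is re-stated here through the mirror `AWinsOld`.)
Refuter seat refuter-cdisprove-stmt-ResolutionOfSingularities-18185-0, 2026-08-17.
-/

noncomputable section

-- single-problem summit: the doubled namespace component `ResolutionOfSingularities` is forced
set_option linter.dupNamespace false

namespace Summit.ResolutionOfSingularities.ResolutionOfSingularities.Theorems.WinToTorsorLUR.Negative

open Summit.ResolutionOfSingularities.ResolutionOfSingularities.Theses.ShadowGame (ShadowGameWinR)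
open Summit.ResolutionOfSingularities.ResolutionOfSingularities.Theorems.ShadowGameWin.Negative
  (clean step play shadow play_succ S0 iSeq tSeq run chart tau cycle not_terminal_of_inCycle)
open Summit.ResolutionOfSingularities.ResolutionOfSingularities.Theorems.ShadowGameWinR.Negative
  (TerminalR AWinsR shadowGameWinR_iff)

/-! ## The clause-free (rev-2) terminal test and inner statement -/

section MirrorR

variable {n : ℕ} {κ : Type} [Field κ] (p : ℕ)

/-- The rev-2 terminal test (clauses 1–2 of the repaired one). [folklore] -/
def TerminalOld (c : (Fin n → ℕ) → κ) : Prop :=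
  (∀ A, clean p c A = 0) ∨
    ∃ A, clean p c A ≠ 0 ∧
      (Finset.sum Finset.univ (fun j => A j) ≤ 1 ∨ ∀ B, clean p c B ≠ 0 → ∀ j, A j ≤ B j)

/-- The old test implies the new one. [folklore] -/
theorem terminalR_of_old {c : (Fin n → ℕ) → κ} (h : TerminalOld p c) : TerminalR p c := by
  rcases h with h | h
  · exact Or.inl h
  · exact Or.inr (Or.inl h)

end MirrorR

/-- The rev-2 inner statement at `(p, n)` (the route's retired `ShadowGameWin`, whose decl is no
longer in the route file; written with the tree's mirror `ShadowGameWin.Negative.{play, clean}`):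
TERMINAL′ with its formal clause deleted. [folklore] -/
def AWinsOld (p n : ℕ) : Prop :=
  ∃ strat : List (Set (Fin n → ℚ)) → List (Fin n) → Finset (Fin n),
    (∀ hs js, (strat hs js).Nonempty) ∧
    ∀ (κ : Type) [Field κ] [CharP κ p] [PerfectField κ] (c₀ : (Fin n → ℕ) → κ) (i : ℕ → Fin n)
      (t : ℕ → Fin n → κ),
      (∀ m, i m ∈ strat (play p strat c₀ i t m).2.1 (play p strat c₀ i t m).2.2) →
        ∃ m, (∀ A, clean p (play p strat c₀ i t m).1 A = 0) ∨
          ∃ A, clean p (play p strat c₀ i t m).1 A ≠ 0 ∧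
            (Finset.sum Finset.univ (fun j => A j) ≤ 1 ∨
              ∀ B, clean p (play p strat c₀ i t m).1 B ≠ 0 → ∀ j, A j ≤ B j)

/-- A rev-2 win is a rev-3 win (the whistle only got more permissive). [folklore] -/
theorem aWinsR_of_aWinsOld (p n : ℕ) (h : AWinsOld p n) : AWinsR p n := by
  obtain ⟨strat, hne, hwin⟩ := h
  refine ⟨strat, hne, fun κ _ _ _ c₀ i t hleg => ?_⟩
  obtain ⟨m, hm⟩ := hwin κ c₀ i t hleg
  exact ⟨m, terminalR_of_old p hm⟩

section RevTwoTrapUse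

open Summit.ResolutionOfSingularities.ResolutionOfSingularities.Theorems.ShadowGameWin.Negative
open Summit.ResolutionOfSingularities.ResolutionOfSingularities.Theorems.WinToTorsorLU.Negative
  (chart_mem run_fst_mem_cycle play_eq_run)

/-- **Any proof of `ShadowGameWinR` must use the formal clause**: without it B's period-6 trap in
`SG_3(2)` over `𝔽₃` from `v² + u³v + u³v²` (tree: `Theorems/ShadowGameWin/Negative/Trap.lean`,
`run_fst_mem_cycle'` / `not_terminal_of_inCycle`) beats every strategy. [folklore] -/
theorem shadowGameWinR_false_without_formalClause :
    ¬ (∀ p : ℕ, p.Prime → ∀ n : ℕ, 0 < n → AWinsOld p n) := by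
  intro hW
  obtain ⟨strat, hne, hwin⟩ := hW 3 (by norm_num) 2 (by norm_num)
  haveI : PerfectField (ZMod 3) := PerfectField.ofFinite
  obtain ⟨m, hm⟩ := hwin (ZMod 3) S0 (iSeq strat) (tSeq strat)
    (fun m => by rw [play_eq_run strat m]; exact chart_mem (hne _ _))
  rw [play_eq_run strat m] at hm
  exact not_terminal_of_inCycle (run_fst_mem_cycle strat hne m) hm

end RevTwoTrapUse

/-- The crux re-pointed at the clause-free antecedent is vacuous: it proves ANY proposition.
[folklore] -/
theorem withoutFormalClause_vacuous (Q : Prop) :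
    (∀ p : ℕ, p.Prime → ∀ n : ℕ, 0 < n → AWinsOld p n) → Q :=
  fun h => absurd h shadowGameWinR_false_without_formalClause

end Summit.ResolutionOfSingularities.ResolutionOfSingularities.Theorems.WinToTorsorLUR.Negative

end
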